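import Summits.QuantumFields.BalabanUV.Beta.SpineRecursiveT2AllCanon
import Summits.QuantumFields.BalabanUV.Beta.SecondOrderClassLiteral

/-!
# `BalabanUV.Beta.SpineRecursiveT2AllFinal` — binder row D1, (L4): **hR FOR THE RECURSIVE WALL LITERAL v2.26 (W := `WrecAt`) ⟸ THE THREE LETTERS,
# THEIR RESIDUAL CLASSES, THE SECOND-ORDER LOCK AND THE TABLE DATA — NOTHING ELSE** (β sub-cell, row BETA-an2 = BINDER-OWNERS row D1 OWNER,
# lineage an2 gen 19)

HONEST FRAMING (cell charter, verbatim): «discharging BetaPertH makes Balaban's UV stability UNCONDITIONAL — a real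
constructive-QFT result; it is NOT the continuum limit and NOT the Clay problem.»  DERIVED cell leaf (wiring, [folklore]); no statement of
Bałaban's papers, no `[cite:]`, no `def`, no `Prop` fact.  EVERY LETTER IS STILL A HYPOTHESIS; the file instantiates no binder of the wall by
itself.  NOT D1, NOT `BetaPertH`, NOT continuum, NOT Clay.

WHAT.  `SpineRecursiveT2AllCanon.…_of_letters_canon` still carried the free remainder family `R2` (with its recursion `hR20`/`hR2succ` and its
classes at levels `j + 1`) and the displayed split symbols `X2s`/`Δ` as binders.  Here `R2` IS CONSTRUCTED by recursion on the level INSIDE the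
proof (`Nat.rec`: level `0` := `cE₂ • RW + RB 0`, step := the displayed right-hand side of `hR2succ` with the displayed `X2s`/`Δ` of
`SecondOrderSplitLiteral` and the canonical second symbol), and its class «`LocStencil₂` + row-parity-odd» at every level is the D1 swarm's CLASS
INDUCTION `SecondOrderClassLiteral.class_R2_all` (leaf-05-g5, row HR-W-CLASS-Q) BY NAME.  Result:

**`axisReflectionCovariant_flipK_TbalOf_JsRecWAtOf_of_letters_final`**: `∀ j, AxisReflectionCovariant (flipK (TbalOf Lc (JsRecWAtOf …) j))`
(`d + 1 = 4`, odd `Lc`, centred root, pins `(cE, cVH) = (Lc⁴, −Lc⁸/2)`) from EXACTLY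
* (hWff) the Wilson (2,2) reflection law at level `0` — `ff`-entrywise, coefficients `(−½, ¼)`, canonical second symbol, odd field-supported
  `LocStencil₂` residual `RW α` [an3's row (W-LET-S₂)₀];
* (hBfm/hBmf/hBmm) the border letter at every level `j ≥ 0` — canonical second symbol, odd `ff`-vanishing `LocStencil₂` residual `RB j α` [an1's (W-0B)];
* (hM2) the mixed letter ∀ j — odd `LocStencilFM` residual `RM j α` [an1's (W-LET-M₂)];
* (hlock2) the second-order units lock (⟺ `cE₂ = Lc⁸`, `SecondOrderLockPin.lock2_iff`; the numeral is DISPLAYED, (R45)/(P6) rule it);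
* the table data: `vh₂S` is `LocStencil₂`, `ff`-vanishing and block-covariant (hB/hB0/hBt), `mixFF` is `LocStencilFM` and covariant (hmix/hmixt).
No `R2`, no `h`, no `X2s`/`Δ`, no `hR2succ`, no class hypothesis on a non-letter object.
Provenance: β sub-cell, unit beta-an2 gen 19, 2026-08-20 (v1); no existing file touched.
-/

open Finset
open scoped BigOperators
open Literature.MathematicalPhysics.QuantumFieldTheory
open Literature.MathematicalPhysics.QuantumFieldTheory.Balaban1983to89
open Literature.MathematicalPhysics.QuantumFieldTheory.Balaban1983to89.Beta
open ExpKernelCalculus (MKer Decays BiLoc comp tadpole VertexFamily VertexFamily₂ shiftK)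
open AffineAveraging (box toSite)
open AveragingContoursRooted (ctr ctrOff ctrOff_mem_box)
open PolarizationSign (reflSign AxisReflectionCovariant)
open KernelReflection (refK refK_apply)
open ResolventReflection (bref Φ)
open OneStepResolventKernel (Fib LocStencil JetData wsum)
open OneStepKernelFamily (KInvStep colH vertexOfK TbalOf flipK)
open StepJetData (wilsonA)
open WilsonBiStencil (wilsonW₂)
open BalabanStepJetsSucc (wE wVH mmRead)
open BalabanCompositeJets (LocStencil₂)
open BalabanStepW2 (M2Of wV4 wB2 locStencil₂_smul' locStencil₂_add')
open SecondOrderResponse (dM W2OfK W2SymOfK LocStencilFM vertex2OfK mixOfK K2OfK)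
open Summit.QuantumFields.BalabanUV.Beta.TameKernelCalculus
open Summit.QuantumFields.BalabanUV.Beta.ChartConjugation (conjV conjW)
open Summit.QuantumFields.BalabanUV.Beta.AxialDressingRooted (coDressKBmAt)
open Summit.QuantumFields.BalabanUV.Beta.BorderedHessian (diagK ctGen bhKStepAt stepScale sgnK)
open Summit.QuantumFields.BalabanUV.Beta.WardLocusCubic (mmSym)
open Summit.QuantumFields.BalabanUV.Beta.KernelWardRemainderParity (parityOdd_add)
open Summit.QuantumFields.BalabanUV.Beta.SpineRecursiveParity (parityOdd_smul)
open Summit.QuantumFields.BalabanUV.Beta.SecondOrderZeroCanon (locStencil₂_diagK_ctGen_mul_ctGen)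
open Summit.QuantumFields.BalabanUV.Beta.SecondOrderClassLiteral (class_R2_all)

noncomputable section

namespace Summit.QuantumFields.BalabanUV.Beta.SpineRooted

section Wall

variable {Lc : ℕ} [NeZero Lc]

/-- [folklore] **hR(v2.26, W := `WrecAt`) ⟸ THE THREE LETTERS + THEIR RESIDUAL CLASSES + THE SECOND-ORDER LOCK + THE TABLE DATA** (see the module docstring). -/
theorem axisReflectionCovariant_flipK_TbalOf_JsRecWAtOf_of_letters_final (hLc : Odd Lc) (cΛ cE₂ cB : ℝ) (T : Fin 4 → Fin 4 → Fin 4 → Fin 4 → ℝ)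
    {vh₂S : Fin 4 → (Fin 4 → ℤ) → Fin 4 → (Fin 4 → ℤ) → MKer 4 (Fib 3)} (hB : ∃ C δ : ℝ, 0 < δ ∧ LocStencil₂ vh₂S C δ)
    (hB0 : ∀ κ u κ' u' (x z : Fin 4 → ℤ) (β β' : Fin 4), vh₂S κ u κ' u' x z (Sum.inl β) (Sum.inl β') = 0)
    {mixFF : Fin 4 → (Fin 4 → ℤ) → Fin 4 → (Fin 4 → ℤ) → MKer 4 (Fib 3)} (hmix : ∃ C δ : ℝ, 0 < δ ∧ LocStencilFM Lc mixFF C δ)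
    (γ : ℕ → ℝ) (hγ : ∀ j, γ j = -((Lc : ℝ) ^ 8 / 2) * wVH 3 Lc j / (stepScale 3 Lc j * (Lc : ℝ) ^ 4))
    (hlock2 : ∀ j, cE₂ * wV4 3 Lc (j + 1) * wVH 3 Lc (j + 1) = ((Lc : ℝ) ^ 4 * wE 3 Lc (j + 1)) ^ 2)
    (RM : ℕ → Fin 4 → Fin 4 → (Fin 4 → ℤ) → Fin 4 → (Fin 4 → ℤ) → MKer 4 (Fib 3))
    (RW : Fin 4 → Fin 4 → (Fin 4 → ℤ) → Fin 4 → (Fin 4 → ℤ) → MKer 4 (Fib 3))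
    (RB : ℕ → Fin 4 → Fin 4 → (Fin 4 → ℤ) → Fin 4 → (Fin 4 → ℤ) → MKer 4 (Fib 3))
    -- (hWff) THE WILSON (2,2) LETTER AT LEVEL 0, PARAMETER-FREE UP TO AN ODD FIELD-SUPPORTED SLOT `RW`
    (hWff : ∀ (α κ : Fin 4) (u : Fin 4 → ℤ) (κ' : Fin 4) (u' : Fin 4 → ℤ) (x z : Fin 4 → ℤ) (β β' : Fin 4),
      wilsonW₂ 3 T κ (bref α κ u) κ' (bref α κ' u') x z (Sum.inl β) (Sum.inl β') =
        ((reflSign α κ * reflSign α κ') • refK (Φ Lc α)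
          (wilsonW₂ 3 T κ u κ' u' +
            conjW (bhKStepAt 3 (toSite (ctrOff 4 Lc)) Lc 0) (wilsonA 3 κ u) (wilsonA 3 κ' u')
              (diagK fun p c => (-(1 / 2 : ℝ)) * ctGen 3 α Lc κ u p c) (diagK fun p c => (-(1 / 2 : ℝ)) * ctGen 3 α Lc κ' u' p c)
              (diagK fun p c => (-(1 / 2 : ℝ)) ^ 2 * (ctGen 3 α Lc κ u p c * ctGen 3 α Lc κ' u' p c)) + RW α κ u κ' u')) x z (Sum.inl β) (Sum.inl β'))
    (hRWl : ∀ α κ u κ' u' (x z : Fin 4 → ℤ) (m : Fin 4) (b' : Fib 3), RW α κ u κ' u' x z (Sum.inr m) b' = 0)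
    (hRWr : ∀ α κ u κ' u' (x z : Fin 4 → ℤ) (a' : Fib 3) (m : Fin 4), RW α κ u κ' u' x z a' (Sum.inr m) = 0)
    (hRWc : ∀ α : Fin 4, ∃ C δ : ℝ, 0 < δ ∧ LocStencil₂ (RW α) C δ)
    (hRWp : ∀ (α : Fin 4) κ u κ' u', trK (RW α κ u κ' u') = -sgnK (RW α κ u κ' u'))
    -- (hM2) THE MIXED LETTER ∀ j
    (hM2 : ∀ (j : ℕ) (α κ : Fin 4) (u : Fin 4 → ℤ) (ρ : Fin 4) (w : Fin 4 → ℤ),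
      M2Of 3 Lc mixFF j κ (bref α κ u) ρ (bref α ρ w) =
        (reflSign α κ * reflSign α ρ) • refK (Φ Lc α)
          (M2Of 3 Lc mixFF j κ u ρ w + conjV (M1At 3 Lc (toSite (ctrOff 4 Lc)) cΛ j ρ w) (diagK fun p c => γ j * ctGen 3 α Lc κ u p c) +
            RM j α κ u ρ w))
    (hRMc : ∀ (j : ℕ) (α : Fin 4), ∃ C δ : ℝ, 0 < δ ∧ LocStencilFM Lc (RM j α) C δ)
    (hRMp : ∀ (j : ℕ) (α : Fin 4) κ u ρ w, trK (RM j α κ u ρ w) = -sgnK (RM j α κ u ρ w))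
    -- (hB*) THE BORDER LETTER AT EVERY LEVEL j ≥ 0, CANONICAL SECOND SYMBOL
    (hRBff : ∀ j α κ u κ' u' (x z : Fin 4 → ℤ) (β β' : Fin 4), RB j α κ u κ' u' x z (Sum.inl β) (Sum.inl β') = 0)
    (hRBc : ∀ (j : ℕ) (α : Fin 4), ∃ C δ : ℝ, 0 < δ ∧ LocStencil₂ (RB j α) C δ)
    (hRBp : ∀ (j : ℕ) (α : Fin 4) κ u κ' u', trK (RB j α κ u κ' u') = -sgnK (RB j α κ u κ' u'))
    (hBfm : ∀ (j : ℕ) (α : Fin 4) κ u κ' u' (x z : Fin 4 → ℤ) (β m : Fin 4),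
      ((cB * wB2 3 Lc j) • vh₂S κ (bref α κ u) κ' (bref α κ' u')) x z (Sum.inl β) (Sum.inr m) =
        ((reflSign α κ * reflSign α κ') • refK (Φ Lc α) ((cB * wB2 3 Lc j) • vh₂S κ u κ' u' +
          conjW (bhKStepAt 3 (toSite (ctrOff 4 Lc)) Lc j)
            (SpureRecAt 3 Lc (toSite (ctrOff 4 Lc)) ((Lc : ℝ) ^ 4) (-((Lc : ℝ) ^ 8 / 2)) cΛ j κ u)
            (SpureRecAt 3 Lc (toSite (ctrOff 4 Lc)) ((Lc : ℝ) ^ 4) (-((Lc : ℝ) ^ 8 / 2)) cΛ j κ' u')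
            (diagK fun p c => γ j * ctGen 3 α Lc κ u p c) (diagK fun p c => γ j * ctGen 3 α Lc κ' u' p c)
            (diagK fun p c => γ j ^ 2 * (ctGen 3 α Lc κ u p c * ctGen 3 α Lc κ' u' p c)) +
          RB j α κ u κ' u')) x z (Sum.inl β) (Sum.inr m))
    (hBmf : ∀ (j : ℕ) (α : Fin 4) κ u κ' u' (x z : Fin 4 → ℤ) (m β : Fin 4),
      ((cB * wB2 3 Lc j) • vh₂S κ (bref α κ u) κ' (bref α κ' u')) x z (Sum.inr m) (Sum.inl β) =
        ((reflSign α κ * reflSign α κ') • refK (Φ Lc α) ((cB * wB2 3 Lc j) • vh₂S κ u κ' u' +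
          conjW (bhKStepAt 3 (toSite (ctrOff 4 Lc)) Lc j)
            (SpureRecAt 3 Lc (toSite (ctrOff 4 Lc)) ((Lc : ℝ) ^ 4) (-((Lc : ℝ) ^ 8 / 2)) cΛ j κ u)
            (SpureRecAt 3 Lc (toSite (ctrOff 4 Lc)) ((Lc : ℝ) ^ 4) (-((Lc : ℝ) ^ 8 / 2)) cΛ j κ' u')
            (diagK fun p c => γ j * ctGen 3 α Lc κ u p c) (diagK fun p c => γ j * ctGen 3 α Lc κ' u' p c)
            (diagK fun p c => γ j ^ 2 * (ctGen 3 α Lc κ u p c * ctGen 3 α Lc κ' u' p c)) +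
          RB j α κ u κ' u')) x z (Sum.inr m) (Sum.inl β))
    (hBmm : ∀ (j : ℕ) (α : Fin 4) κ u κ' u' (x z : Fin 4 → ℤ) (m m' : Fin 4),
      ((cB * wB2 3 Lc j) • vh₂S κ (bref α κ u) κ' (bref α κ' u')) x z (Sum.inr m) (Sum.inr m') =
        ((reflSign α κ * reflSign α κ') • refK (Φ Lc α) ((cB * wB2 3 Lc j) • vh₂S κ u κ' u' +
          conjW (bhKStepAt 3 (toSite (ctrOff 4 Lc)) Lc j)
            (SpureRecAt 3 Lc (toSite (ctrOff 4 Lc)) ((Lc : ℝ) ^ 4) (-((Lc : ℝ) ^ 8 / 2)) cΛ j κ u)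
            (SpureRecAt 3 Lc (toSite (ctrOff 4 Lc)) ((Lc : ℝ) ^ 4) (-((Lc : ℝ) ^ 8 / 2)) cΛ j κ' u')
            (diagK fun p c => γ j * ctGen 3 α Lc κ u p c) (diagK fun p c => γ j * ctGen 3 α Lc κ' u' p c)
            (diagK fun p c => γ j ^ 2 * (ctGen 3 α Lc κ u p c * ctGen 3 α Lc κ' u' p c)) +
          RB j α κ u κ' u')) x z (Sum.inr m) (Sum.inr m'))
    (hBt : ∀ (κ : Fin 4) (u : Fin 4 → ℤ) (κ' : Fin 4) (u' t : Fin 4 → ℤ),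
      vh₂S κ (u + (Lc : ℤ) • t) κ' (u' + (Lc : ℤ) • t) = shiftK (-((Lc : ℤ) • t)) (vh₂S κ u κ' u'))
    (hmixt : ∀ (κ : Fin 4) (u : Fin 4 → ℤ) (μ : Fin 4) (w t : Fin 4 → ℤ),
      mixFF κ (u + (Lc : ℤ) • t) μ (w + t) = shiftK (-((Lc : ℤ) • t)) (mixFF κ u μ w))
    :
    ∀ j : ℕ, AxisReflectionCovariant
      (flipK (TbalOf Lc (JsRecWAtOf (d := 3) hLc.pos (ctrOff_mem_box hLc.pos) ((Lc : ℝ) ^ 4) (-((Lc : ℝ) ^ 8 / 2)) cΛ cE₂ cB T hB hmix) j)) := by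
  have hL1 : 1 ≤ Lc := hLc.pos
  have hr := ctrOff_mem_box (d := 4) hL1
  -- THE REMAINDER FAMILY, CONSTRUCTED BY RECURSION ON THE LEVEL (level 0 := `cE₂ • RW + RB 0`; step := the displayed right-hand side of
  -- `hR2succ` with the displayed `X2s`/`Δ` and the canonical second symbol), packaged with its two defining equations
  have key : ∀ (z : Fin 4 → Fin 4 → (Fin 4 → ℤ) → Fin 4 → (Fin 4 → ℤ) → MKer 4 (Fib 3)) (s : ℕ → (Fin 4 → Fin 4 → (Fin 4 → ℤ) → Fin 4 → (Fin 4 → ℤ) → MKer 4 (Fib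
              3)) → Fin 4 → Fin 4 → (Fin 4 → ℤ) → Fin 4 → (Fin 4 → ℤ) → MKer 4 (Fib 3)),
      ∃ R2 : ℕ → Fin 4 → Fin 4 → (Fin 4 → ℤ) → Fin 4 → (Fin 4 → ℤ) → MKer 4 (Fib 3), R2 0 = z ∧ ∀ j : ℕ, R2 (j + 1) = s j (R2 j) :=
    fun z s => ⟨Nat.rec (motive := fun _ => Fin 4 → Fin 4 → (Fin 4 → ℤ) → Fin 4 → (Fin 4 → ℤ) → MKer 4 (Fib 3)) z s, Nat.rec_zero z s, fun j => Nat.rec_add_one z s j⟩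
  obtain ⟨R2, hR20F, hR2succF⟩ := key (fun α κ u κ' u' => cE₂ • RW α κ u κ' u' + RB 0 α κ u κ' u')
    (fun j prev α κ u κ' u' =>
      -((cE₂ * wV4 3 Lc (j + 1)) • mmRead Lc (comp (comp (coDressKBmAt (toSite (ctrOff 4 Lc)) Lc (KInvStep (d := 3) Lc j)) ((1 / 2 : ℝ) • conjV (bhKStepAt 3 (toSite
              (ctrOff 4 Lc)) Lc j) (diagK fun p a => ((∑ κ₁, ∑' u₁, colH (coDressKBmAt (toSite (ctrOff 4 Lc)) Lc (KInvStep (d := 3) Lc j)) Lc κ' u' κ₁ u₁ * ∑ κ₂, ∑'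
              u₂, colH (coDressKBmAt (toSite (ctrOff 4 Lc)) Lc (KInvStep (d := 3) Lc j)) Lc κ u κ₂ u₂ * (γ j ^ 2 * (ctGen 3 α Lc κ₁ u₁ p a * ctGen 3 α Lc κ₂ u₂ p a)))
            + ∑ κ₁, ∑' u₁, colH (K2OfK (coDressKBmAt (toSite (ctrOff 4 Lc)) Lc (KInvStep (d := 3) Lc j)) Lc (SpureRecAt 3 Lc (toSite (ctrOff 4 Lc)) ((Lc : ℝ) ^ 4)
                (-((Lc : ℝ) ^ 8 / 2)) cΛ j) (M1At 3 Lc (toSite (ctrOff 4 Lc)) cΛ j) κ u + (-(comp (comp (coDressKBmAt (toSite (ctrOff 4 Lc)) Lc (KInvStep (d := 3) Lc j))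
            (conjV (bhKStepAt 3 (toSite (ctrOff 4 Lc)) Lc j) (diagK fun p c => ∑ κ₃, ∑' u₃, colH (coDressKBmAt (toSite (ctrOff 4 Lc)) Lc (KInvStep (d := 3) Lc j))
                Lc κ u κ₃ u₃ * (γ j * ctGen 3 α Lc κ₃ u₃ p c)))) (coDressKBmAt (toSite (ctrOff 4 Lc)) Lc (KInvStep (d := 3) Lc j))))) Lc κ' u' κ₁ u₁ * (γ j * ctGen
                3 α Lc κ₁ u₁ p a))
            - ((∑ κ₁, ∑' u₁, colH (coDressKBmAt (toSite (ctrOff 4 Lc)) Lc (KInvStep (d := 3) Lc j)) Lc κ u κ₁ u₁ * ∑ κ₂, ∑' u₂, colH (coDressKBmAt (toSite (ctrOff 4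
                Lc)) Lc (KInvStep (d := 3) Lc j)) Lc κ' u' κ₂ u₂ * (γ j ^ 2 * (ctGen 3 α Lc κ₁ u₁ p a * ctGen 3 α Lc κ₂ u₂ p a)))
            + ∑ κ₁, ∑' u₁, colH (K2OfK (coDressKBmAt (toSite (ctrOff 4 Lc)) Lc (KInvStep (d := 3) Lc j)) Lc (SpureRecAt 3 Lc (toSite (ctrOff 4 Lc)) ((Lc : ℝ) ^ 4)
                (-((Lc : ℝ) ^ 8 / 2)) cΛ j) (M1At 3 Lc (toSite (ctrOff 4 Lc)) cΛ j) κ' u' + (-(comp (comp (coDressKBmAt (toSite (ctrOff 4 Lc)) Lc (KInvStep (d := 3)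
                Lc j))
            (conjV (bhKStepAt 3 (toSite (ctrOff 4 Lc)) Lc j) (diagK fun p c => ∑ κ₃, ∑' u₃, colH (coDressKBmAt (toSite (ctrOff 4 Lc)) Lc (KInvStep (d := 3) Lc j))
                Lc κ' u' κ₃ u₃ * (γ j * ctGen 3 α Lc κ₃ u₃ p c)))) (coDressKBmAt (toSite (ctrOff 4 Lc)) Lc (KInvStep (d := 3) Lc j))))) Lc κ u κ₁ u₁ * (γ j * ctGen
                3 α Lc κ₁ u₁ p a)))
            + (1 / 2 : ℝ) • ((dM (-(comp (comp (coDressKBmAt (toSite (ctrOff 4 Lc)) Lc (KInvStep (d := 3) Lc j))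
            (conjV (bhKStepAt 3 (toSite (ctrOff 4 Lc)) Lc j) (diagK fun p c => ∑ κ₃, ∑' u₃, colH (coDressKBmAt (toSite (ctrOff 4 Lc)) Lc (KInvStep (d := 3) Lc j))
                Lc κ' u' κ₃ u₃ * (γ j * ctGen 3 α Lc κ₃ u₃ p c)))) (coDressKBmAt (toSite (ctrOff 4 Lc)) Lc (KInvStep (d := 3) Lc j)))) Lc (SpureRecAt 3 Lc (toSite
                (ctrOff 4 Lc)) ((Lc : ℝ) ^ 4) (-((Lc : ℝ) ^ 8 / 2)) cΛ j) (M1At 3 Lc (toSite (ctrOff 4 Lc)) cΛ j) κ u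
            + (vertex2OfK (coDressKBmAt (toSite (ctrOff 4 Lc)) Lc (KInvStep (d := 3) Lc j)) Lc (prev α) κ u κ' u'
            + (mixOfK (coDressKBmAt (toSite (ctrOff 4 Lc)) Lc (KInvStep (d := 3) Lc j)) Lc (RM j α) κ u κ' u'
            + mixOfK (coDressKBmAt (toSite (ctrOff 4 Lc)) Lc (KInvStep (d := 3) Lc j)) Lc (RM j α) κ' u' κ u)))
            + (dM (-(comp (comp (coDressKBmAt (toSite (ctrOff 4 Lc)) Lc (KInvStep (d := 3) Lc j))
            (conjV (bhKStepAt 3 (toSite (ctrOff 4 Lc)) Lc j) (diagK fun p c => ∑ κ₃, ∑' u₃, colH (coDressKBmAt (toSite (ctrOff 4 Lc)) Lc (KInvStep (d := 3) Lc j))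
                Lc κ u κ₃ u₃ * (γ j * ctGen 3 α Lc κ₃ u₃ p c)))) (coDressKBmAt (toSite (ctrOff 4 Lc)) Lc (KInvStep (d := 3) Lc j)))) Lc (SpureRecAt 3 Lc (toSite
                (ctrOff 4 Lc)) ((Lc : ℝ) ^ 4) (-((Lc : ℝ) ^ 8 / 2)) cΛ j) (M1At 3 Lc (toSite (ctrOff 4 Lc)) cΛ j) κ' u'
            + (vertex2OfK (coDressKBmAt (toSite (ctrOff 4 Lc)) Lc (KInvStep (d := 3) Lc j)) Lc (prev α) κ' u' κ u
            + (mixOfK (coDressKBmAt (toSite (ctrOff 4 Lc)) Lc (KInvStep (d := 3) Lc j)) Lc (RM j α) κ' u' κ u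
            + mixOfK (coDressKBmAt (toSite (ctrOff 4 Lc)) Lc (KInvStep (d := 3) Lc j)) Lc (RM j α) κ u κ' u')))))) (coDressKBmAt (toSite (ctrOff 4 Lc)) Lc (KInvStep
                (d := 3) Lc j))))
            + RB (j + 1) α κ u κ' u'
            + conjV (mmRead Lc (coDressKBmAt (toSite (ctrOff 4 Lc)) Lc (KInvStep (d := 3) Lc j))) (diagK fun p c => cE₂ * wV4 3 Lc (j + 1) * mmSym Lc (fun p c =>
                ((∑ κ₁, ∑' u₁, colH (coDressKBmAt (toSite (ctrOff 4 Lc)) Lc (KInvStep (d := 3) Lc j)) Lc κ u κ₁ u₁ * ∑ κ₂, ∑' u₂, colH (coDressKBmAt (toSite (ctrOff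
                4 Lc)) Lc (KInvStep (d := 3) Lc j)) Lc κ' u' κ₂ u₂ * (γ j ^ 2 * (ctGen 3 α Lc κ₁ u₁ p c * ctGen 3 α Lc κ₂ u₂ p c)))
            + ∑ κ₁, ∑' u₁, colH (K2OfK (coDressKBmAt (toSite (ctrOff 4 Lc)) Lc (KInvStep (d := 3) Lc j)) Lc (SpureRecAt 3 Lc (toSite (ctrOff 4 Lc)) ((Lc : ℝ) ^ 4)
                (-((Lc : ℝ) ^ 8 / 2)) cΛ j) (M1At 3 Lc (toSite (ctrOff 4 Lc)) cΛ j) κ' u' + (-(comp (comp (coDressKBmAt (toSite (ctrOff 4 Lc)) Lc (KInvStep (d := 3)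
                Lc j))
            (conjV (bhKStepAt 3 (toSite (ctrOff 4 Lc)) Lc j) (diagK fun p c => ∑ κ₃, ∑' u₃, colH (coDressKBmAt (toSite (ctrOff 4 Lc)) Lc (KInvStep (d := 3) Lc j))
                Lc κ' u' κ₃ u₃ * (γ j * ctGen 3 α Lc κ₃ u₃ p c)))) (coDressKBmAt (toSite (ctrOff 4 Lc)) Lc (KInvStep (d := 3) Lc j))))) Lc κ u κ₁ u₁ * (γ j * ctGen
                3 α Lc κ₁ u₁ p c))) p c
            - wVH 3 Lc (j + 1) * (γ (j + 1) ^ 2 * (ctGen 3 α Lc κ u p c * ctGen 3 α Lc κ' u' p c))))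
  have hR20 : ∀ (α κ : Fin 4) (u : Fin 4 → ℤ) (κ' : Fin 4) (u' : Fin 4 → ℤ), R2 0 α κ u κ' u' = cE₂ • RW α κ u κ' u' + RB 0 α κ u κ' u' :=
    fun α κ u κ' u' => by rw [hR20F]
  have hR2succ := fun (j : ℕ) (α κ : Fin 4) (u : Fin 4 → ℤ) (κ' : Fin 4) (u' : Fin 4 → ℤ) =>
    congrFun (congrFun (congrFun (congrFun (congrFun (hR2succF j) α) κ) u) κ') u'
  have hR20' : ∀ α : Fin 4, R2 0 α = fun κ u κ' u' => cE₂ • RW α κ u κ' u' + RB 0 α κ u κ' u' := fun α => by rw [hR20F]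
  -- the level-0 class
  have h0l : ∀ α : Fin 4, ∃ C δ : ℝ, 0 < δ ∧ LocStencil₂ (R2 0 α) C δ := by
    intro α
    obtain ⟨C₁, δ₁, hδ₁, h1⟩ := hRWc α
    obtain ⟨C₂, δ₂, hδ₂, h2⟩ := hRBc 0 α
    refine ⟨|cE₂| * C₁ + C₂, min δ₁ δ₂, lt_min hδ₁ hδ₂, ?_⟩
    rw [hR20' α]
    exact locStencil₂_add' (locStencil₂_smul' cE₂ (h1.mono (min_le_left _ _))) (h2.mono (min_le_right _ _))
  have h0p : ∀ (α κ : Fin 4) (u : Fin 4 → ℤ) (κ' : Fin 4) (u' : Fin 4 → ℤ), trK (R2 0 α κ u κ' u') = -sgnK (R2 0 α κ u κ' u') := by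
    intro α κ u κ' u'
    rw [hR20]
    exact parityOdd_add (parityOdd_smul cE₂ (hRWp α κ u κ' u')) (hRBp 0 α κ u κ' u')
  -- THE CLASS INDUCTION (leaf-05-g5's `class_R2_all`, canonical second symbol, the wall's coefficients)
  have hcls := class_R2_all (d := 3) hL1 hr ((Lc : ℝ) ^ 4) (-((Lc : ℝ) ^ 8 / 2)) cΛ γ (fun j => cE₂ * wV4 3 Lc (j + 1)) (fun j => wVH 3 Lc (j + 1))
    (fun j α κ u κ' u' p c => γ j ^ 2 * (ctGen 3 α Lc κ u p c * ctGen 3 α Lc κ' u' p c))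
    (fun j α => ⟨_, 1, one_pos, locStencil₂_diagK_ctGen_mul_ctGen α Lc (γ j ^ 2) zero_le_one⟩) RM RB R2 hRMc hRMp hRBc hRBp h0l h0p
    hR2succ
  exact axisReflectionCovariant_flipK_TbalOf_JsRecWAtOf_of_letters_canon hLc cΛ cE₂ cB T hB hB0 hmix γ hγ hlock2 R2 RM RW RB hWff hRWl hRWr hRWc
    hRWp hM2 hRMc hRMp hRBff hRBc hRBp hBfm hBmf hBmm
    (fun j α μ y ν y' p c => ((∑ κ₁, ∑' u₁, colH (coDressKBmAt (toSite (ctrOff 4 Lc)) Lc (KInvStep (d := 3) Lc j)) Lc μ y κ₁ u₁ * ∑ κ₂, ∑' u₂, colH (coDressKBmAt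
              (toSite (ctrOff 4 Lc)) Lc (KInvStep (d := 3) Lc j)) Lc ν y' κ₂ u₂ * (γ j ^ 2 * (ctGen 3 α Lc κ₁ u₁ p c * ctGen 3 α Lc κ₂ u₂ p c)))
            + ∑ κ₁, ∑' u₁, colH (K2OfK (coDressKBmAt (toSite (ctrOff 4 Lc)) Lc (KInvStep (d := 3) Lc j)) Lc (SpureRecAt 3 Lc (toSite (ctrOff 4 Lc)) ((Lc : ℝ) ^ 4)
                (-((Lc : ℝ) ^ 8 / 2)) cΛ j) (M1At 3 Lc (toSite (ctrOff 4 Lc)) cΛ j) ν y' + (-(comp (comp (coDressKBmAt (toSite (ctrOff 4 Lc)) Lc (KInvStep (d := 3) Lc j))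
            (conjV (bhKStepAt 3 (toSite (ctrOff 4 Lc)) Lc j) (diagK fun p c => ∑ κ₃, ∑' u₃, colH (coDressKBmAt (toSite (ctrOff 4 Lc)) Lc (KInvStep (d := 3) Lc j))
                Lc ν y' κ₃ u₃ * (γ j * ctGen 3 α Lc κ₃ u₃ p c)))) (coDressKBmAt (toSite (ctrOff 4 Lc)) Lc (KInvStep (d := 3) Lc j))))) Lc μ y κ₁ u₁ * (γ j * ctGen 3
                α Lc κ₁ u₁ p c)))
    (fun j α μ y ν y' => (dM (-(comp (comp (coDressKBmAt (toSite (ctrOff 4 Lc)) Lc (KInvStep (d := 3) Lc j))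
            (conjV (bhKStepAt 3 (toSite (ctrOff 4 Lc)) Lc j) (diagK fun p c => ∑ κ₃, ∑' u₃, colH (coDressKBmAt (toSite (ctrOff 4 Lc)) Lc (KInvStep (d := 3) Lc j))
                Lc ν y' κ₃ u₃ * (γ j * ctGen 3 α Lc κ₃ u₃ p c)))) (coDressKBmAt (toSite (ctrOff 4 Lc)) Lc (KInvStep (d := 3) Lc j)))) Lc (SpureRecAt 3 Lc (toSite
                (ctrOff 4 Lc)) ((Lc : ℝ) ^ 4) (-((Lc : ℝ) ^ 8 / 2)) cΛ j) (M1At 3 Lc (toSite (ctrOff 4 Lc)) cΛ j) μ y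
            + (vertex2OfK (coDressKBmAt (toSite (ctrOff 4 Lc)) Lc (KInvStep (d := 3) Lc j)) Lc (R2 j α) μ y ν y'
            + (mixOfK (coDressKBmAt (toSite (ctrOff 4 Lc)) Lc (KInvStep (d := 3) Lc j)) Lc (RM j α) μ y ν y'
            + mixOfK (coDressKBmAt (toSite (ctrOff 4 Lc)) Lc (KInvStep (d := 3) Lc j)) Lc (RM j α) ν y' μ y))))
    rfl rfl hR20 hR2succ (fun j α => (hcls (j + 1) α).1) (fun j α => (hcls (j + 1) α).2) hBt hmixt

/-- [folklore] **THE SAME AT THE PIN `cE₂ = Lc⁸`** ((W-L-2) discharged by `SecondOrderLockPin.lock2_of_bcj2`; the numeral is DISPLAYED, not ruled —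
(R45)/(P6) are the β-leads'): hR(v2.26-W) ⟸ the three letters + their residual classes + the table data ONLY. -/
theorem axisReflectionCovariant_flipK_TbalOf_JsRecWAtOf_of_letters_final_bcj2 (hLc : Odd Lc) (cΛ cB : ℝ) (T : Fin 4 → Fin 4 → Fin 4 → Fin 4 → ℝ)
    {vh₂S : Fin 4 → (Fin 4 → ℤ) → Fin 4 → (Fin 4 → ℤ) → MKer 4 (Fib 3)} (hB : ∃ C δ : ℝ, 0 < δ ∧ LocStencil₂ vh₂S C δ)
    (hB0 : ∀ κ u κ' u' (x z : Fin 4 → ℤ) (β β' : Fin 4), vh₂S κ u κ' u' x z (Sum.inl β) (Sum.inl β') = 0)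
    {mixFF : Fin 4 → (Fin 4 → ℤ) → Fin 4 → (Fin 4 → ℤ) → MKer 4 (Fib 3)} (hmix : ∃ C δ : ℝ, 0 < δ ∧ LocStencilFM Lc mixFF C δ)
    (γ : ℕ → ℝ) (hγ : ∀ j, γ j = -((Lc : ℝ) ^ 8 / 2) * wVH 3 Lc j / (stepScale 3 Lc j * (Lc : ℝ) ^ 4))
    (RM : ℕ → Fin 4 → Fin 4 → (Fin 4 → ℤ) → Fin 4 → (Fin 4 → ℤ) → MKer 4 (Fib 3))
    (RW : Fin 4 → Fin 4 → (Fin 4 → ℤ) → Fin 4 → (Fin 4 → ℤ) → MKer 4 (Fib 3))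
    (RB : ℕ → Fin 4 → Fin 4 → (Fin 4 → ℤ) → Fin 4 → (Fin 4 → ℤ) → MKer 4 (Fib 3))
    -- (hWff) THE WILSON (2,2) LETTER AT LEVEL 0, PARAMETER-FREE UP TO AN ODD FIELD-SUPPORTED SLOT `RW`
    (hWff : ∀ (α κ : Fin 4) (u : Fin 4 → ℤ) (κ' : Fin 4) (u' : Fin 4 → ℤ) (x z : Fin 4 → ℤ) (β β' : Fin 4),
      wilsonW₂ 3 T κ (bref α κ u) κ' (bref α κ' u') x z (Sum.inl β) (Sum.inl β') =
        ((reflSign α κ * reflSign α κ') • refK (Φ Lc α)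
          (wilsonW₂ 3 T κ u κ' u' +
            conjW (bhKStepAt 3 (toSite (ctrOff 4 Lc)) Lc 0) (wilsonA 3 κ u) (wilsonA 3 κ' u')
              (diagK fun p c => (-(1 / 2 : ℝ)) * ctGen 3 α Lc κ u p c) (diagK fun p c => (-(1 / 2 : ℝ)) * ctGen 3 α Lc κ' u' p c)
              (diagK fun p c => (-(1 / 2 : ℝ)) ^ 2 * (ctGen 3 α Lc κ u p c * ctGen 3 α Lc κ' u' p c)) + RW α κ u κ' u')) x z (Sum.inl β) (Sum.inl β'))
    (hRWl : ∀ α κ u κ' u' (x z : Fin 4 → ℤ) (m : Fin 4) (b' : Fib 3), RW α κ u κ' u' x z (Sum.inr m) b' = 0)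
    (hRWr : ∀ α κ u κ' u' (x z : Fin 4 → ℤ) (a' : Fib 3) (m : Fin 4), RW α κ u κ' u' x z a' (Sum.inr m) = 0)
    (hRWc : ∀ α : Fin 4, ∃ C δ : ℝ, 0 < δ ∧ LocStencil₂ (RW α) C δ)
    (hRWp : ∀ (α : Fin 4) κ u κ' u', trK (RW α κ u κ' u') = -sgnK (RW α κ u κ' u'))
    -- (hM2) THE MIXED LETTER ∀ j
    (hM2 : ∀ (j : ℕ) (α κ : Fin 4) (u : Fin 4 → ℤ) (ρ : Fin 4) (w : Fin 4 → ℤ),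
      M2Of 3 Lc mixFF j κ (bref α κ u) ρ (bref α ρ w) =
        (reflSign α κ * reflSign α ρ) • refK (Φ Lc α)
          (M2Of 3 Lc mixFF j κ u ρ w + conjV (M1At 3 Lc (toSite (ctrOff 4 Lc)) cΛ j ρ w) (diagK fun p c => γ j * ctGen 3 α Lc κ u p c) +
            RM j α κ u ρ w))
    (hRMc : ∀ (j : ℕ) (α : Fin 4), ∃ C δ : ℝ, 0 < δ ∧ LocStencilFM Lc (RM j α) C δ)
    (hRMp : ∀ (j : ℕ) (α : Fin 4) κ u ρ w, trK (RM j α κ u ρ w) = -sgnK (RM j α κ u ρ w))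
    -- (hB*) THE BORDER LETTER AT EVERY LEVEL j ≥ 0, CANONICAL SECOND SYMBOL
    (hRBff : ∀ j α κ u κ' u' (x z : Fin 4 → ℤ) (β β' : Fin 4), RB j α κ u κ' u' x z (Sum.inl β) (Sum.inl β') = 0)
    (hRBc : ∀ (j : ℕ) (α : Fin 4), ∃ C δ : ℝ, 0 < δ ∧ LocStencil₂ (RB j α) C δ)
    (hRBp : ∀ (j : ℕ) (α : Fin 4) κ u κ' u', trK (RB j α κ u κ' u') = -sgnK (RB j α κ u κ' u'))
    (hBfm : ∀ (j : ℕ) (α : Fin 4) κ u κ' u' (x z : Fin 4 → ℤ) (β m : Fin 4),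
      ((cB * wB2 3 Lc j) • vh₂S κ (bref α κ u) κ' (bref α κ' u')) x z (Sum.inl β) (Sum.inr m) =
        ((reflSign α κ * reflSign α κ') • refK (Φ Lc α) ((cB * wB2 3 Lc j) • vh₂S κ u κ' u' +
          conjW (bhKStepAt 3 (toSite (ctrOff 4 Lc)) Lc j)
            (SpureRecAt 3 Lc (toSite (ctrOff 4 Lc)) ((Lc : ℝ) ^ 4) (-((Lc : ℝ) ^ 8 / 2)) cΛ j κ u)
            (SpureRecAt 3 Lc (toSite (ctrOff 4 Lc)) ((Lc : ℝ) ^ 4) (-((Lc : ℝ) ^ 8 / 2)) cΛ j κ' u')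
            (diagK fun p c => γ j * ctGen 3 α Lc κ u p c) (diagK fun p c => γ j * ctGen 3 α Lc κ' u' p c)
            (diagK fun p c => γ j ^ 2 * (ctGen 3 α Lc κ u p c * ctGen 3 α Lc κ' u' p c)) +
          RB j α κ u κ' u')) x z (Sum.inl β) (Sum.inr m))
    (hBmf : ∀ (j : ℕ) (α : Fin 4) κ u κ' u' (x z : Fin 4 → ℤ) (m β : Fin 4),
      ((cB * wB2 3 Lc j) • vh₂S κ (bref α κ u) κ' (bref α κ' u')) x z (Sum.inr m) (Sum.inl β) =
        ((reflSign α κ * reflSign α κ') • refK (Φ Lc α) ((cB * wB2 3 Lc j) • vh₂S κ u κ' u' +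
          conjW (bhKStepAt 3 (toSite (ctrOff 4 Lc)) Lc j)
            (SpureRecAt 3 Lc (toSite (ctrOff 4 Lc)) ((Lc : ℝ) ^ 4) (-((Lc : ℝ) ^ 8 / 2)) cΛ j κ u)
            (SpureRecAt 3 Lc (toSite (ctrOff 4 Lc)) ((Lc : ℝ) ^ 4) (-((Lc : ℝ) ^ 8 / 2)) cΛ j κ' u')
            (diagK fun p c => γ j * ctGen 3 α Lc κ u p c) (diagK fun p c => γ j * ctGen 3 α Lc κ' u' p c)
            (diagK fun p c => γ j ^ 2 * (ctGen 3 α Lc κ u p c * ctGen 3 α Lc κ' u' p c)) +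
          RB j α κ u κ' u')) x z (Sum.inr m) (Sum.inl β))
    (hBmm : ∀ (j : ℕ) (α : Fin 4) κ u κ' u' (x z : Fin 4 → ℤ) (m m' : Fin 4),
      ((cB * wB2 3 Lc j) • vh₂S κ (bref α κ u) κ' (bref α κ' u')) x z (Sum.inr m) (Sum.inr m') =
        ((reflSign α κ * reflSign α κ') • refK (Φ Lc α) ((cB * wB2 3 Lc j) • vh₂S κ u κ' u' +
          conjW (bhKStepAt 3 (toSite (ctrOff 4 Lc)) Lc j)
            (SpureRecAt 3 Lc (toSite (ctrOff 4 Lc)) ((Lc : ℝ) ^ 4) (-((Lc : ℝ) ^ 8 / 2)) cΛ j κ u)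
            (SpureRecAt 3 Lc (toSite (ctrOff 4 Lc)) ((Lc : ℝ) ^ 4) (-((Lc : ℝ) ^ 8 / 2)) cΛ j κ' u')
            (diagK fun p c => γ j * ctGen 3 α Lc κ u p c) (diagK fun p c => γ j * ctGen 3 α Lc κ' u' p c)
            (diagK fun p c => γ j ^ 2 * (ctGen 3 α Lc κ u p c * ctGen 3 α Lc κ' u' p c)) +
          RB j α κ u κ' u')) x z (Sum.inr m) (Sum.inr m'))
    (hBt : ∀ (κ : Fin 4) (u : Fin 4 → ℤ) (κ' : Fin 4) (u' t : Fin 4 → ℤ),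
      vh₂S κ (u + (Lc : ℤ) • t) κ' (u' + (Lc : ℤ) • t) = shiftK (-((Lc : ℤ) • t)) (vh₂S κ u κ' u'))
    (hmixt : ∀ (κ : Fin 4) (u : Fin 4 → ℤ) (μ : Fin 4) (w t : Fin 4 → ℤ),
      mixFF κ (u + (Lc : ℤ) • t) μ (w + t) = shiftK (-((Lc : ℤ) • t)) (mixFF κ u μ w))
    :
    ∀ j : ℕ, AxisReflectionCovariant
      (flipK (TbalOf Lc (JsRecWAtOf (d := 3) hLc.pos (ctrOff_mem_box hLc.pos) ((Lc : ℝ) ^ 4) (-((Lc : ℝ) ^ 8 / 2)) cΛ ((Lc : ℝ) ^ 8) cB T hB hmix) j)) :=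
  axisReflectionCovariant_flipK_TbalOf_JsRecWAtOf_of_letters_final hLc cΛ ((Lc : ℝ) ^ 8) cB T hB hB0 hmix γ hγ (lock2_of_bcj2 _ rfl) RM RW RB hWff
    hRWl hRWr hRWc hRWp hM2 hRMc hRMp hRBff hRBc hRBp hBfm hBmf hBmm hBt hmixt

end Wall

end Summit.QuantumFields.BalabanUV.Beta.SpineRooted

end
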